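import Summits.ResolutionOfSingularities.ResolutionOfSingularities.Theorems.FrobeniusLadderFInjectiveMacaulayficationDoublePointFermatCubicGerm
import Summits.ResolutionOfSingularities.ResolutionOfSingularities.Theorems.FrobeniusLadderFInjectiveMacaulayficationStalkChartIso
import HarnessLib

/-!
# The FULL model of the double point `x₀² + x₁³ + ⋯ + x_{m+3}³ = 0` (char 2) is NOT REGULAR — as a statement about the MODEL SCHEME `Bl_v X = affineBlowup (x̄)`
# (crux `FInjectiveMacaulayfication` stmt-ResolutionOfSingularities-15315, chain w45a; res-L1-w45a-stub-1 g9 OFFER (D): scheme-level upgrade of the census certificate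
# `DoublePointFermatCubicGerm.chart_one_singular_point`; seat res-L1-w45a-stub-1 g9)

[OURS · L1 W4.5a] Support file (`--supports stmt-ResolutionOfSingularities-15315 --as helper`); replaces the role of NO printed item; NOT a
statement of the manuscript; def-free, unconditional; a CERTIFICATE. AI-written (AI review is weaker than expert review).

## What is here
* §1 (generic, any hypersurface) `exists_not_mem_regularLocus_affineBlowup_of_chart` — **a NON-REGULAR prime of a strict-transform chart ring `k[X]/(gᵢ)` gives a
  NON-REGULAR point of the point blow-up `affineBlowup (x̄₀, …, x̄_{n−1})` of the hypersurface `k[X]/(f)`**: the chart ring is the degree-zero localisation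
  `(R[𝔪t])_{(x̄ᵢt)}` (`StrictTransformChartN.stub_strictTransformChartN`), whose `Spec` is an open subscheme of the blow-up (`Proj.awayι`, an open immersion:
  isomorphic stalks), and local rings transport along the presentation isomorphism (`BlowupFiModelOfCover.nonempty_ringEquiv_localization_of_ringEquiv`).
* §2 ★ `affineBlowup_doublePoint_not_regular` — for `f = X₀² + Σ_{l<m+3} X_{l+1}³` in characteristic 2, **the one-point blow-up `affineBlowup (x̄)` — FULL at every
  point by `DoublePointFermatCubicGerm.affineBlowup_vertex_fullCl` — has a point that is NOT regular** (from `DoublePointFermatCubicGerm.chart_one_singular_point`);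
  ★★ `affineBlowup_doublePoint_full_and_not_regular` — the conjunction «FULL everywhere ∧ not regular»: the INFORMATIVE STRATUM «FULL model still singular»
  (res-L1-w45a-tri-2 #348 (c)) as ONE kernel statement about the model scheme.

[folklore mathematics, OURS as a certificate; cite: StacksProject, Tag 0804 (charts of a blowing up), Tag 01HH (open immersions); Hartshorne1977, I Thm. 5.1]
-/

-- single-problem summit: the doubled namespace component is forced
set_option linter.dupNamespace false

noncomputable section

open AlgebraicGeometry CategoryTheory Literature.AlgebraicGeometry.Resolution TopologicalSpace IsLocalRing MvPolynomial

namespace Summit.ResolutionOfSingularities.ResolutionOfSingularities.Theorems.FInjectiveMacaulayfication.DoublePointFermatCubicModelSingular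

open Summit.ResolutionOfSingularities.ResolutionOfSingularities.Theorems.FInjectiveMacaulayfication
open SliceableCentre GermOfGlobalBlowup DoublePointFermatCubicCharts DoublePointFermatCubicGerm

/-! ## §1 A non-regular prime of a strict-transform chart gives a non-regular point of the blow-up -/

-- budget: the chart-ring types make unification on this statement expensive (as in `StrictTransformChartN`)
set_option maxHeartbeats 800000 in
/-- **Chart primes are points of the blow-up, with the same local ring.** For a hypersurface `R = k[X]/(f)` (`(f)` prime, `f ≠ 0`), a chart index `i`
with strict transform `g` (`θᵢ f = Xᵢ^μ g`, `(g)` prime, `Xᵢ ∉ (g)`), and a prime `Q` of `k[X]/(g)` whose local ring is NOT regular, the point blow-up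
`affineBlowup (x̄₀, …, x̄_{n−1})` has a point outside its regular locus: transport `Q` along the presentation `k[X]/(g) ≅ (R[𝔪t])_{(x̄ᵢt)}`
(`StrictTransformChartN.stub_strictTransformChartN`) and push it into `Proj R[𝔪t]` by the open immersion `Proj.awayι` (isomorphic stalks).
[cite: StacksProject, Tag 0804; Tag 01HH] -/
theorem exists_not_mem_regularLocus_affineBlowup_of_chart (k : Type) [Field k] (n : ℕ) (f g : MvPolynomial (Fin n) k) (i : Fin n) (μ : ℕ)
    (hfprime : (Ideal.span {f}).IsPrime) (hf0 : f ≠ 0) (hg : (Ideal.span {g}).IsPrime) (hXi : MvPolynomial.X i ∉ Ideal.span {g})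
    (hθ : MvPolynomial.aeval (fun j : Fin n => if j = i then (MvPolynomial.X i : MvPolynomial (Fin n) k)
        else MvPolynomial.X j * MvPolynomial.X i) f = MvPolynomial.X i ^ μ * g)
    (Q : Ideal (MvPolynomial (Fin n) k ⧸ Ideal.span {g})) [Q.IsPrime] (hQ : ¬ IsRegularLocalRing (Localization.AtPrime Q)) :
    ∃ y : ↥(affineBlowup (Ideal.span (Set.range fun j : Fin n => Ideal.Quotient.mk (Ideal.span {f}) (MvPolynomial.X j)))),
      y ∉ Scheme.regularLocus (affineBlowup (Ideal.span (Set.range fun j : Fin n => Ideal.Quotient.mk (Ideal.span {f}) (MvPolynomial.X j)))) := by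
  -- the presentation `e : k[X]/(g) ≅ A = (R[𝔪t])_{(x̄ᵢ t)}`
  obtain ⟨e, -⟩ := StrictTransformChartN.stub_strictTransformChartN k n f g i μ hfprime hf0 hg hXi hθ
    (fun j : Fin n => Ideal.Quotient.mk (Ideal.span {f}) (MvPolynomial.X j)) rfl
  -- the prime `q = e(Q)` of `A` and `A_q ≅ (k[X]/(g))_Q`
  set q : Ideal (HomogeneousLocalization.Away (reesGrading (Ideal.span (Set.range fun j : Fin n =>
      Ideal.Quotient.mk (Ideal.span {f}) (MvPolynomial.X j))))
      (reesT ((fun j : Fin n => Ideal.Quotient.mk (Ideal.span {f}) (MvPolynomial.X j)) i) (Ideal.subset_span (Set.mem_range_self i)))) :=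
    Q.comap e.symm.toRingHom with hqdef
  haveI hq : q.IsPrime := Ideal.comap_isPrime _ _
  obtain ⟨eQ⟩ := BlowupFiModelOfCover.nonempty_ringEquiv_localization_of_ringEquiv e Q q (fun a => by
    rw [hqdef, Ideal.mem_comap]
    change e.symm (e a) ∈ Q ↔ a ∈ Q
    rw [e.symm_apply_apply])
  have hq' : ¬ IsRegularLocalRing (Localization.AtPrime q) := fun h => hQ (IsRegularLocalRing.of_ringEquiv eQ.symm)
  -- the point of `Spec A` and its image under the open immersion `Proj.awayι`
  let q₀ : Spec (.of (HomogeneousLocalization.Away (reesGrading (Ideal.span (Set.range fun j : Fin n =>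
      Ideal.Quotient.mk (Ideal.span {f}) (MvPolynomial.X j))))
      (reesT ((fun j : Fin n => Ideal.Quotient.mk (Ideal.span {f}) (MvPolynomial.X j)) i) (Ideal.subset_span (Set.mem_range_self i))))) :=
    ⟨q, hq⟩
  have hq₀ : q₀ ∉ Scheme.regularLocus _ := not_mem_regularLocus_Spec_of_not_isRegularLocalRing q₀ hq'
  let ι := Proj.awayι (reesGrading (Ideal.span (Set.range fun j : Fin n => Ideal.Quotient.mk (Ideal.span {f}) (MvPolynomial.X j))))
    (reesT ((fun j : Fin n => Ideal.Quotient.mk (Ideal.span {f}) (MvPolynomial.X j)) i) (Ideal.subset_span (Set.mem_range_self i)))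
    (reesT_mem _ (Ideal.subset_span (Set.mem_range_self i))) Nat.one_pos
  refine ⟨ι q₀, fun hy => hq₀ ?_⟩
  -- the stalk map of the open immersion at `q₀` is an isomorphism
  haveI : IsRegularLocalRing ((affineBlowup (Ideal.span (Set.range fun j : Fin n =>
      Ideal.Quotient.mk (Ideal.span {f}) (MvPolynomial.X j)))).presheaf.stalk (ι q₀)) := hy
  exact IsRegularLocalRing.of_ringEquiv (asIso (ι.stalkMap q₀)).commRingCatIsoToRingEquiv

/-! ## §2 The FULL model of the double point is not regular -/

/-- ★ **The one-point blow-up `affineBlowup (x̄)` of the double point `x₀² + Σ x_{l+1}³ = 0` (characteristic 2) has a NON-REGULAR point** — the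
singular point of the `X₁`-chart of `DoublePointFermatCubicGerm.chart_one_singular_point`, pushed into the model by
`exists_not_mem_regularLocus_affineBlowup_of_chart`. [folklore mathematics; OURS as a certificate] -/
theorem affineBlowup_doublePoint_not_regular (k : Type) [Field k] [CharP k 2] (m : ℕ) (f : MvPolynomial (Fin (m + 4)) k)
    (hf : f = X 0 ^ 2 + ∑ l : Fin (m + 3), X l.succ ^ 3) :
    ∃ y : ↥(affineBlowup (Ideal.span (Set.range fun j : Fin (m + 4) => Ideal.Quotient.mk (Ideal.span {f}) (X j)))),
      y ∉ Scheme.regularLocus (affineBlowup (Ideal.span (Set.range fun j : Fin (m + 4) => Ideal.Quotient.mk (Ideal.span {f}) (X j)))) := by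
  have hprime := prime_f k m f hf
  have hfprime : (Ideal.span {f}).IsPrime := (Ideal.span_singleton_prime hprime.ne_zero).mpr hprime
  have hθ := theta_succ k m f hf 0
  have hgprime : (Ideal.span {(X 0 ^ 2 + X (0 : Fin (m + 3)).succ * (1 + ∑ j : Fin (m + 2),
      (X (((0 : Fin (m + 3)).succAbove j).succ) : MvPolynomial (Fin (m + 4)) k) ^ 3))}).IsPrime :=
    (PrimeTransfer.stub_primeTransfer k (m + 4) (0 : Fin (m + 3)).succ f _ 2 hθ (f_not_mem_span_X k m f hf _)
      (g_succ_not_mem_span_X k m 0)).mp hfprime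
  have hXi := PrimeTransfer.X_not_mem_span_of_isPrime hgprime (g_succ_not_mem_span_X k m 0)
  obtain ⟨Q, hQmax, -, hQ⟩ := chart_one_singular_point k m
  haveI := hQmax
  exact exists_not_mem_regularLocus_affineBlowup_of_chart k (m + 4) f _ (0 : Fin (m + 3)).succ 2 hfprime hprime.ne_zero hgprime hXi hθ Q hQ

/-- ★★ **FULL EVERYWHERE AND NOT REGULAR**: the one-point blow-up of the double point `x₀² + Σ_{l<m+3} x_{l+1}³ = 0 ⊂ 𝔸^{m+4}` (characteristic 2) is FULL
(domain ∧ Cohen–Macaulay ∧ Frobenius-closed parameter ideals) at EVERY point and has a point that is NOT regular — the INFORMATIVE STRATUM «FULL model still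
singular» of the F-half's instance census as one kernel statement about the model scheme: F-injective FULL-ification strictly short of resolution.
[folklore mathematics; OURS as a certificate] -/
theorem affineBlowup_doublePoint_full_and_not_regular (k : Type) [Field k] [CharP k 2] (m : ℕ) (f : MvPolynomial (Fin (m + 4)) k)
    (hf : f = X 0 ^ 2 + ∑ l : Fin (m + 3), X l.succ ^ 3) :
    (∀ y : ↥(affineBlowup (Ideal.span (Set.range fun j : Fin (m + 4) => Ideal.Quotient.mk (Ideal.span {f}) (X j)))),
      FullCl 2 ((affineBlowup (Ideal.span (Set.range fun j : Fin (m + 4) =>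
        Ideal.Quotient.mk (Ideal.span {f}) (X j)))).presheaf.stalk y)) ∧
    ∃ y : ↥(affineBlowup (Ideal.span (Set.range fun j : Fin (m + 4) => Ideal.Quotient.mk (Ideal.span {f}) (X j)))),
      y ∉ Scheme.regularLocus (affineBlowup (Ideal.span (Set.range fun j : Fin (m + 4) => Ideal.Quotient.mk (Ideal.span {f}) (X j)))) :=
  ⟨affineBlowup_vertex_fullCl k m f hf, affineBlowup_doublePoint_not_regular k m f hf⟩

end Summit.ResolutionOfSingularities.ResolutionOfSingularities.Theorems.FInjectiveMacaulayfication.DoublePointFermatCubicModelSingular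

end
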